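import Mathlib
import Summits.Schanuel.Schanuel.Theorems.RigidCoreAclSubsetLogFreeCoreCaseIILstep

/-!
# Case II core, file 3: minimal polynomials over a `θ`-stable subfield; semi-invariant algebraic
elements are monomials
(helper file for the registered stub `stub_caseII_core` of line `eac-extends-core-automorphisms`,
crux stmt-Schanuel-0968 `Summit.Schanuel.Schanuel.Theses.RigidCore.AclSubsetLogFreeCore`)

Pure field theory.  `θ` is a ring automorphism of a field `E`, `K ≤ E` a subfield with `θ K = K`.

* `exists_restrict_equiv` — `θ` restricts to an automorphism `ψ` of `K`.
* `minpoly_map_restrict` — transport: `(minpoly K x).map ψ = minpoly K (θ x)`.  Hence a `θ`-fixed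
  element algebraic over `K` is algebraic over the fixed field of `θ` in `K`
  (`coeff_minpoly_fixed`), and for a SEMI-INVARIANT element `θ r = u r` (`u ∈ Kˣ`) the constant
  coefficient `c₀` of `minpoly K r` is semi-invariant with multiplier `u ^ d` (`d` the degree) while
  `r ^ d / c₀` is fixed (`coeff_zero_minpoly_semi`).
* **`semiInvariant_algebraic_eq_mul`** — the engine of the descent in the core claim: let `k ≤ K` be a
  relatively algebraically closed subfield (closed under roots) and `Mon ⊆ K` a set of "monomials"
  closed under powers and roots; if the `θ`-fixed elements of `K` lie in `k` (FixF) and the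
  semi-invariant elements of `K` with multiplier in `Mon` are of the form `c * m` (`c ∈ k`, `m ∈ Mon`)
  (SemiF), then every non-zero element of `E` ALGEBRAIC over `K` and semi-invariant with multiplier
  in `Mon` is of the form `c * m` as well; and a fixed element algebraic over `K` lies in `k`
  (`mem_of_fixed_of_isAlgebraic`).
-/

noncomputable section

set_option linter.dupNamespace false

open Polynomial

namespace Summit.Schanuel.Schanuel.Theorems.RigidCore

namespace CaseIICore

variable {E : Type*} [Field E]

/-! ### Restriction of an automorphism to a stable subfield -/

/-- A ring automorphism restricts to an automorphism of a stable subfield. [folklore] -/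
theorem exists_restrict_equiv (θ : E ≃+* E) (K : Subfield E) (hK : ∀ z, z ∈ K ↔ θ z ∈ K) :
    ∃ ψ : K ≃+* K, ∀ z : K, (ψ z : E) = θ z := by
  let f : K →+* K := θ.toRingHom.restrict K.toSubring K.toSubring fun z hz => (hK z).1 hz
  have hf : ∀ z : K, (f z : E) = θ z := fun z => rfl
  have hbij : Function.Bijective f := by
    constructor
    · intro a b hab
      have h := congrArg (fun z : K => (z : E)) hab
      simp only [hf] at h
      exact Subtype.ext (θ.injective h)
    · intro b
      refine ⟨⟨θ.symm b, (hK _).2 (by rw [θ.apply_symm_apply]; exact b.2)⟩, Subtype.ext ?_⟩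
      rw [hf]; exact θ.apply_symm_apply _
  exact ⟨RingEquiv.ofBijective f hbij, fun z => hf z⟩

/-! ### Transport of minimal polynomials -/

/-- **Transport of the minimal polynomial**: `(minpoly K x).map ψ = minpoly K (θ x)` for the
restriction `ψ` of `θ` to the `θ`-stable subfield `K` and `x` integral over `K`. [folklore] -/
theorem minpoly_map_restrict (θ : E ≃+* E) (K : Subfield E) (ψ : K ≃+* K)
    (hψ : ∀ z : K, (ψ z : E) = θ z) {x : E} (hx : IsIntegral K x) :
    (minpoly K x).map ψ.toRingHom = minpoly K (θ x) := by
  -- evaluation transported along `θ`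
  have hcomp : (algebraMap K E).comp ψ.toRingHom = θ.toRingHom.comp (algebraMap K E) :=
    RingHom.ext fun z => hψ z
  have key : ∀ (p : K[X]) (y : E), aeval (θ y) (p.map ψ.toRingHom) = θ (aeval y p) := by
    intro p y
    rw [aeval_def, aeval_def, eval₂_map, hcomp]
    exact (hom_eval₂ p (algebraMap K E) θ.toRingHom y).symm
  have hθx : IsIntegral K (θ x) := by
    refine ⟨(minpoly K x).map ψ.toRingHom, (minpoly.monic hx).map _, ?_⟩
    rw [← aeval_def, key, minpoly.aeval, map_zero]
  refine minpoly.unique K (θ x) ((minpoly.monic hx).map _) ?_ fun r hr hr0 => ?_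
  · rw [key, minpoly.aeval, map_zero]
  · -- a polynomial killing `θ x` pulled back along `ψ` kills `x`
    have h1 : aeval x (r.map ψ.symm.toRingHom) = 0 := by
      apply θ.injective
      rw [← key, Polynomial.map_map, show ψ.toRingHom.comp ψ.symm.toRingHom = RingHom.id K from
        RingHom.ext fun z => ψ.apply_symm_apply z, Polynomial.map_id, hr0, map_zero]
    have h2 := minpoly.min K x (hr.map ψ.symm.toRingHom) h1
    rw [degree_map] at h2 ⊢
    exact h2

/-- The coefficients of the minimal polynomial of a `θ`-FIXED element integral over the stable
subfield `K` are `θ`-fixed. [folklore] -/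
theorem coeff_minpoly_fixed (θ : E ≃+* E) (K : Subfield E) (hK : ∀ z, z ∈ K ↔ θ z ∈ K)
    {x : E} (hx : IsIntegral K x) (hfix : θ x = x) (n : ℕ) :
    θ ((minpoly K x).coeff n : E) = (minpoly K x).coeff n := by
  obtain ⟨ψ, hψ⟩ := exists_restrict_equiv θ K hK
  have h := minpoly_map_restrict θ K ψ hψ hx
  rw [hfix] at h
  have hn := congrArg (fun p : K[X] => ((p.coeff n : K) : E)) h
  simp only [coeff_map] at hn
  rw [← hψ]
  exact hn

/-- A root of a non-zero polynomial over `K` all of whose coefficients lie in the subfield `k` is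
algebraic over `k`. [folklore] -/
theorem isAlgebraic_of_coeff_mem {K : Subfield E} (k : Subfield E) {p : K[X]} (hp : p ≠ 0)
    (hcoeff : ∀ n, ((p.coeff n : K) : E) ∈ k) {x : E} (hx : aeval x p = 0) : IsAlgebraic k x := by
  refine (CaseIILstep.isAlgebraic_iff_exists_coeff_mem (T := k) (T₀ := (k : Set E))
    (fun y hy => ⟨⟨y, hy⟩, rfl⟩) (fun t => t.2) (fun _ _ e => Subtype.ext e)).2
    ⟨p.map (algebraMap K E), (Polynomial.map_ne_zero_iff (algebraMap K E).injective).2 hp,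
      fun n => ?_, ?_⟩
  · rw [coeff_map]; exact hcoeff n
  · rw [IsRoot.def, eval_map, ← aeval_def, hx]

/-- **Fixed and algebraic over `K` ⟹ in `k`**, when the fixed field of `θ` in `K` lies in the
relatively algebraically closed subfield `k`. [folklore] -/
theorem mem_of_fixed_of_isAlgebraic (θ : E ≃+* E) (K k : Subfield E)
    (hK : ∀ z, z ∈ K ↔ θ z ∈ K) (hk : ∀ z, IsAlgebraic k z → z ∈ k)
    (hFixF : ∀ z ∈ K, θ z = z → z ∈ k)
    {x : E} (hx : IsAlgebraic K x) (hfix : θ x = x) : x ∈ k := by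
  have hxi : IsIntegral K x := hx.isIntegral
  refine hk x (isAlgebraic_of_coeff_mem k (minpoly.ne_zero hxi) (fun n => ?_) (minpoly.aeval K x))
  exact hFixF _ ((minpoly K x).coeff n).2 (coeff_minpoly_fixed θ K hK hxi hfix n)

/-- **Semi-invariant elements: the constant coefficient.** If `x` is integral over the `θ`-stable
subfield `K` and `θ x = u * x` with `u ∈ K`, `u ≠ 0`, then, with `d = deg minpoly_K x` and
`c₀ = (minpoly K x).coeff 0`: `θ c₀ = u ^ d * c₀` and `θ (x ^ d) = u ^ d * x ^ d`. (The minimal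
polynomial of `u x` is `u ^ d · μ(u⁻¹ X)` and is also the `ψ`-transport of `μ = minpoly K x`.)
[folklore] -/
theorem coeff_zero_minpoly_semi (θ : E ≃+* E) (K : Subfield E) (hK : ∀ z, z ∈ K ↔ θ z ∈ K)
    {x : E} (hx : IsIntegral K x) {u : E} (huK : u ∈ K) (hu0 : u ≠ 0) (hsemi : θ x = u * x) :
    θ ((minpoly K x).coeff 0 : E) = u ^ (minpoly K x).natDegree * (minpoly K x).coeff 0 ∧
      θ (x ^ (minpoly K x).natDegree) = u ^ (minpoly K x).natDegree * x ^ (minpoly K x).natDegree := by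
  obtain ⟨ψ, hψ⟩ := exists_restrict_equiv θ K hK
  set μ := minpoly K x with hμ
  set d := μ.natDegree with hd
  set uK : K := ⟨u, huK⟩ with huK'
  have huK0 : uK ≠ 0 := fun h => hu0 (congrArg Subtype.val h)
  -- `ν = u^d · μ(u⁻¹ X)` is monic of degree `d` with root `u x`
  set ν : K[X] := C (uK ^ d) * μ.comp (C uK⁻¹ * X) with hν
  have hμmo : μ.Monic := minpoly.monic hx
  have hlin : (C uK⁻¹ * X : K[X]).natDegree = 1 := by
    rw [natDegree_C_mul (inv_ne_zero huK0), natDegree_X]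
  have hcompdeg : (μ.comp (C uK⁻¹ * X)).natDegree = d := by
    rw [natDegree_comp, hlin, mul_one]
  have hcomplead : (μ.comp (C uK⁻¹ * X)).leadingCoeff = uK⁻¹ ^ d := by
    rw [leadingCoeff_comp (by rw [hlin]; exact one_ne_zero), hμmo.leadingCoeff, one_mul,
      leadingCoeff_C_mul_X, hd]
  have hνdeg : ν.natDegree = d := by
    rw [hν, natDegree_C_mul (pow_ne_zero _ huK0), hcompdeg]
  have hνmo : ν.Monic := by
    rw [Monic, hν, leadingCoeff_mul, leadingCoeff_C, hcomplead, ← mul_pow, mul_inv_cancel₀ huK0,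
      one_pow]
  have hνroot : aeval (u * x) ν = 0 := by
    have h1 : aeval (u * x) (C uK⁻¹ * X : K[X]) = x := by
      rw [map_mul, aeval_C, aeval_X, show (algebraMap K E) uK⁻¹ = u⁻¹ from rfl, ← mul_assoc,
        inv_mul_cancel₀ hu0, one_mul]
    rw [hν, map_mul, aeval_comp, h1, minpoly.aeval, mul_zero]
  -- `minpoly K (θ x) = μ.map ψ` has degree `d`, divides `ν`, so equals `ν`
  have hmap : μ.map ψ.toRingHom = minpoly K (u * x) := by
    rw [hμ, minpoly_map_restrict θ K ψ hψ hx, hsemi]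
  have hux : IsIntegral K (u * x) := (isIntegral_algebraMap (x := uK)).mul hx
  have hdvd : μ.map ψ.toRingHom ∣ ν := by rw [hmap]; exact minpoly.dvd K (u * x) hνroot
  have heq : μ.map ψ.toRingHom = ν :=
    (eq_of_monic_of_dvd_of_natDegree_le (p := μ.map ψ.toRingHom) (q := ν) (hμmo.map _) hνmo hdvd
      (by rw [hνdeg, natDegree_map, hd])).symm
  constructor
  · -- constant coefficients
    have h0 : ((ψ.toRingHom (μ.coeff 0) : K) : E) = ((ν.coeff 0 : K) : E) := by
      have h := congrArg (fun p : K[X] => ((p.coeff 0 : K) : E)) heq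
      simpa only [coeff_map] using h
    rw [RingEquiv.toRingHom_eq_coe, RingEquiv.coe_toRingHom, hψ] at h0
    rw [h0, hν, coeff_C_mul, coeff_zero_eq_eval_zero, eval_comp]
    simp only [eval_mul, eval_C, eval_X, mul_zero, ← coeff_zero_eq_eval_zero]
    push_cast
    rfl
  · rw [map_pow, hsemi, mul_pow]

/-! ### Semi-invariant algebraic elements are monomials -/

/-- **The descent engine of the core claim.**  Let `k ≤ K ≤ E` be subfields, `K` stable under the
ring automorphism `θ` of `E`, `k` relatively algebraically closed in `E` and containing all roots of
unity and all roots of its elements (e.g. `E` algebraically closed), and let `Mon ⊆ K` be a set of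
non-zero "monomials" closed under powers and under extraction of roots.  Assume
(FixF) every `θ`-fixed element of `K` lies in `k`, and (SemiF) every non-zero `z ∈ K` with
`θ z = u * z` for some `u ∈ Mon` is of the form `c * m`, `c ∈ k`, `m ∈ Mon`.  Then every non-zero
`r ∈ E` ALGEBRAIC over `K` with `θ r = u * r`, `u ∈ Mon`, is of the form `c * m` (`c ∈ k`,
`m ∈ Mon`).  (Constant coefficient `c₀` of `minpoly K r`: `θ c₀ = u^d c₀`, so `c₀ = c·m` by SemiF;
`r^d / c₀` is fixed and algebraic over `K`, hence in `k` by FixF; take `d`-th roots.) [folklore] -/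
theorem semiInvariant_algebraic_eq_mul (θ : E ≃+* E) (K k : Subfield E)
    (hK : ∀ z, z ∈ K ↔ θ z ∈ K) (hk : ∀ z, IsAlgebraic k z → z ∈ k)
    (hkroot : ∀ c ∈ k, ∀ d : ℕ, 0 < d → ∃ c' ∈ k, c' ^ d = c)
    (Mon : Set E) (hMonK : Mon ⊆ K) (hMon0 : ∀ m ∈ Mon, m ≠ 0)
    (hMonpow : ∀ m ∈ Mon, ∀ n : ℕ, m ^ n ∈ Mon)
    (hMonroot : ∀ m ∈ Mon, ∀ d : ℕ, 0 < d → ∃ m' ∈ Mon, m' ^ d = m)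
    (hFixF : ∀ z ∈ K, θ z = z → z ∈ k)
    (hSemiF : ∀ z ∈ K, z ≠ 0 → ∀ u ∈ Mon, θ z = u * z → ∃ c ∈ k, ∃ m ∈ Mon, z = c * m)
    {r : E} (hr : IsAlgebraic K r) (hr0 : r ≠ 0) {u : E} (hu : u ∈ Mon) (hsemi : θ r = u * r) :
    ∃ c ∈ k, ∃ m ∈ Mon, r = c * m := by
  have hri : IsIntegral K r := hr.isIntegral
  set μ := minpoly K r with hμ
  set d := μ.natDegree with hd
  have hdpos : 0 < d := minpoly.natDegree_pos hri
  have hu0 : u ≠ 0 := hMon0 u hu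
  obtain ⟨hc₀, hrd⟩ := coeff_zero_minpoly_semi θ K hK hri (hMonK hu) hu0 hsemi
  set c₀ : E := ((μ.coeff 0 : K) : E) with hc₀def
  have hc₀K : c₀ ∈ K := (μ.coeff 0).2
  have hc₀0 : c₀ ≠ 0 := fun h =>
    (minpoly.coeff_zero_ne_zero hri hr0) (Subtype.ext h)
  -- `c₀ = c * m` by SemiF
  obtain ⟨c, hc, m, hm, hcm⟩ := hSemiF c₀ hc₀K hc₀0 (u ^ d) (hMonpow u hu d) hc₀
  -- `r^d / c₀` is fixed and algebraic over `K`, hence in `k`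
  set r₁ : E := r ^ d * c₀⁻¹ with hr₁
  have hr₁fix : θ r₁ = r₁ := by
    rw [hr₁, map_mul, map_inv₀, hrd, hc₀, mul_inv, mul_mul_mul_comm, mul_inv_cancel₀
      (pow_ne_zero _ hu0), one_mul]
  have hr₁alg : IsAlgebraic K r₁ :=
    (hr.pow d).mul (isAlgebraic_algebraMap (μ.coeff 0)).inv
  have hr₁k : r₁ ∈ k := mem_of_fixed_of_isAlgebraic θ K k hK hk hFixF hr₁alg hr₁fix
  -- `r^d = (r₁ c) m`; take `d`-th roots
  have hrdeq : r ^ d = (r₁ * c) * m := by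
    rw [hr₁, mul_assoc, mul_assoc, ← hcm, inv_mul_cancel₀ hc₀0, mul_one]
  have hr₁c : r₁ * c ∈ k := mul_mem hr₁k hc
  obtain ⟨c', hc', hc'd⟩ := hkroot _ hr₁c d hdpos
  obtain ⟨m', hm', hm'd⟩ := hMonroot m hm d hdpos
  have hm'0 : m' ≠ 0 := hMon0 m' hm'
  have hc'0 : c' ≠ 0 := by
    rintro rfl
    rw [zero_pow hdpos.ne'] at hc'd
    rw [← hc'd, zero_mul] at hrdeq
    exact hr0 (pow_eq_zero_iff hdpos.ne' |>.1 hrdeq)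
  set ζ : E := r * (c' * m')⁻¹ with hζ
  have hζd : ζ ^ d = 1 := by
    rw [hζ, mul_pow, inv_pow, mul_pow, hc'd, hm'd, hrdeq, mul_inv_cancel₀]
    exact mul_ne_zero (by rw [← hc'd]; exact pow_ne_zero _ hc'0) (hMon0 m hm)
  have hζk : ζ ∈ k := by
    refine hk ζ ⟨X ^ d - 1, ?_, ?_⟩
    · exact (monic_X_pow_sub_C (1 : k) hdpos.ne').ne_zero
    · rw [map_sub, map_pow, aeval_X, hζd, map_one, sub_self]
  refine ⟨ζ * c', mul_mem hζk hc', m', hm', ?_⟩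
  rw [hζ, mul_assoc (r * (c' * m')⁻¹), mul_assoc r, inv_mul_cancel₀ (mul_ne_zero hc'0 hm'0), mul_one]

end CaseIICore

/-! ### Registered helper (crux stub list of stmt-Schanuel-0968) -/

/-- **Registered form of `CaseIICore.semiInvariant_algebraic_eq_mul`** (all binders explicit): the
descent engine — semi-invariant elements algebraic over `K` are monomials, given (FixF) and (SemiF)
on `K`. [folklore] -/
theorem caseII_semiInvariant_algebraic_eq_mul {E : Type*} [Field E] (θ : E ≃+* E) (K k : Subfield E)
    (hK : ∀ z, z ∈ K ↔ θ z ∈ K) (hk : ∀ z, IsAlgebraic k z → z ∈ k)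
    (hkroot : ∀ c ∈ k, ∀ d : ℕ, 0 < d → ∃ c' ∈ k, c' ^ d = c)
    (Mon : Set E) (hMonK : Mon ⊆ K) (hMon0 : ∀ m ∈ Mon, m ≠ 0)
    (hMonpow : ∀ m ∈ Mon, ∀ n : ℕ, m ^ n ∈ Mon)
    (hMonroot : ∀ m ∈ Mon, ∀ d : ℕ, 0 < d → ∃ m' ∈ Mon, m' ^ d = m)
    (hFixF : ∀ z ∈ K, θ z = z → z ∈ k)
    (hSemiF : ∀ z ∈ K, z ≠ 0 → ∀ u ∈ Mon, θ z = u * z → ∃ c ∈ k, ∃ m ∈ Mon, z = c * m)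
    {r : E} (hr : IsAlgebraic K r) (hr0 : r ≠ 0) {u : E} (hu : u ∈ Mon) (hsemi : θ r = u * r) :
    ∃ c ∈ k, ∃ m ∈ Mon, r = c * m :=
  CaseIICore.semiInvariant_algebraic_eq_mul θ K k hK hk hkroot Mon hMonK hMon0 hMonpow hMonroot hFixF
    hSemiF hr hr0 hu hsemi

end Summit.Schanuel.Schanuel.Theorems.RigidCore
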